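import Mathlib
import HarnessLib

/-!
# Integral Substitution Helpers for Far Log-Kernel Estimates

This file provides substitution lemmas for transforming the far log-kernel integrals
via the change of variables v = u/x.

## Main Results

* `integrand_subst`: The integrand simplifies under v = u/x substitution
* `Ioi_integral_subst`: The Ioi integral transforms correctly via v = u/x

These are used in the stub_farLogKernelSharp proof for the Remainder0Xi crux.

## References

Supports stmt-RiemannHypothesis-24730 (Remainder0Xi crux).
-/

set_option linter.dupNamespace false
namespace Summit.RiemannHypothesis.RiemannHypothesis.Theorems.EarlyAppointmentsRemainder0Xi.SubstitutionHelpers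

open scoped BigOperators Topology Classical
open Real Complex MeasureTheory Set Filter

/-- The integrand simplifies under v = u/x substitution:
    x * [log(xv/(2π)) * 2x/(x² - (xv)²)] = log(xv/(2π)) * 2/(1-v²)
    for v ≠ ±1 and x ≠ 0. -/
theorem integrand_subst {x v : ℝ} (hx : x ≠ 0) (hv : 1 - v ^ 2 ≠ 0) :
    x * (Real.log (x * v / (2 * π)) * (2 * x / (x ^ 2 - (x * v) ^ 2))) =
    Real.log (x * v / (2 * π)) * (2 / (1 - v ^ 2)) := by
  have hx2 : x ^ 2 ≠ 0 := pow_ne_zero 2 hx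
  have hdenom : x ^ 2 - (x * v) ^ 2 = x ^ 2 * (1 - v ^ 2) := by ring
  rw [hdenom]
  have hdenom_ne : x ^ 2 * (1 - v ^ 2) ≠ 0 := mul_ne_zero hx2 hv
  field_simp [hdenom_ne, hv]

/-- The Ioi integral transformation using v = u/x.

    ∫ u in Ioi (x + R/2), log(u/(2π)) * 2x/(x² - u²)
    = x * ∫ v in Ioi (1 + R/(2x)), log(xv/(2π)) * 2x/(x² - (xv)²)

This is a direct application of `MeasureTheory.integral_comp_mul_left_Ioi`. -/
theorem Ioi_integral_subst {x R : ℝ} (hx : 0 < x) :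
    ∫ u in Ioi (x + R / 2), Real.log (u / (2 * π)) * (2 * x / (x ^ 2 - u ^ 2)) =
    x * ∫ v in Ioi (1 + R / (2 * x)), Real.log (x * v / (2 * π)) * (2 * x / (x ^ 2 - (x * v) ^ 2)) := by
  have hxne : x ≠ 0 := hx.ne'
  have hba : x * (1 + R / (2 * x)) = x + R / 2 := by field_simp
  let g : ℝ → ℝ := fun u => Real.log (u / (2 * π)) * (2 * x / (x ^ 2 - u ^ 2))
  have hcomp : (fun v => g (x * v)) = (fun v => Real.log (x * v / (2 * π)) * (2 * x / (x ^ 2 - (x * v) ^ 2))) := by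
    ext v; simp only [g]
  have hsub := MeasureTheory.integral_comp_mul_left_Ioi g (1 + R / (2 * x)) hx
  rw [hba] at hsub
  calc ∫ u in Ioi (x + R / 2), g u
      = x • (x⁻¹ • ∫ u in Ioi (x + R / 2), g u) := by rw [smul_smul, mul_inv_cancel₀ hxne, one_smul]
    _ = x • ∫ v in Ioi (1 + R / (2 * x)), g (x * v) := by rw [← hsub]
    _ = x * ∫ v in Ioi (1 + R / (2 * x)), Real.log (x * v / (2 * π)) * (2 * x / (x ^ 2 - (x * v) ^ 2)) := by
        rw [smul_eq_mul, hcomp]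

end Summit.RiemannHypothesis.RiemannHypothesis.Theorems.EarlyAppointmentsRemainder0Xi.SubstitutionHelpers
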